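import Summits.BirchSwinnertonDyer.Rank1Residual.ManinAdditive.UFamilyPrimality
import Summits.BirchSwinnertonDyer.BirchSwinnertonDyer.Theorems.ManinLocalTwoThreeUFamilyNegOneTwin
import HarnessLib

/-!
# es §56's REPAIRED `u`-family rows: E-es-163R ⟺ E-es-164R and «a flat witness at `4 ∥ N` refutes E-es-164» modulo MODULARITY ONLY
# (cell `bsd-f2-manin`, es g35 `ManinAdditive/UFamilyPrimality.lean`, T-es-66; crux C2 `ManinOddAtFour`, stmt-BirchSwinnertonDyer-22967; prover p2 gen 19)

es's glue in `UFamilyPrimality.lean` takes the pairing rows S-es-g34-1 `UFamilyNegOneTwinAtSixteen` / S-es-g34-1′ `UFamilyNegOneTwinAtFour` as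
hypotheses; both are theorems modulo `exists_isNewformOf` (`UFamilyTwin.uFamilyNegOneTwinAtSixteen_of_modularity`,
`…AtFour_of_modularity`, p743305).  Hence, modulo the Modularity Theorem alone:
* `uFamilyCuspidalImageNonzero_fourP_iff_sixteenP_of_modularity` — E-es-163R `UFamilyCuspidalImageNonzeroAtFourP` ⟺ E-es-164R
  `UFamilyCuspidalImageNonzeroAtSixteenP` (the repaired `4 ∥ N` / `16 ∥ N` cusp-image laws on the PRIME sub-family are one law);
* `not_uFamilyCuspidalImageNonzeroAtConductorSixteen_of_flat_four_of_modularity` — a flat witness at `4 ∥ N` (table fact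
  `UFamilyFlatWitnessAtFour`: 1220a1, …) refutes the misstated E-es-164 as well.
CONDITIONAL bookkeeping (hypothesis `exists_isNewformOf`); the laws themselves stay OPEN; BSD / Manin / C2 are not proved.  No `sorry`,
no definition.
-/

set_option linter.dupNamespace false
set_option autoImplicit false

noncomputable section

open Literature.NumberTheory.EllipticCurves.ModularForms
  Summit.BirchSwinnertonDyer.Rank1Residual.ManinAdditive

namespace Summit.BirchSwinnertonDyer.BirchSwinnertonDyer.Theorems.ManinLocalTwoThree.UFamilyTwin

/-- **E-es-163R ⟺ E-es-164R granted modularity** (es's `uFamilyCuspidalImageNonzero_fourP_iff_sixteenP` with both pairing rows discharged).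
[cite: BCDTJAMS2001, Thm. A] -/
theorem uFamilyCuspidalImageNonzero_fourP_iff_sixteenP_of_modularity (hnf : exists_isNewformOf) :
    UFamilyCuspidalImageNonzeroAtFourP ↔ UFamilyCuspidalImageNonzeroAtSixteenP :=
  uFamilyCuspidalImageNonzero_fourP_iff_sixteenP (uFamilyNegOneTwinAtSixteen_of_modularity hnf)
    (uFamilyNegOneTwinAtFour_of_modularity hnf)

/-- **A flat witness at `4 ∥ N` refutes E-es-164, granted modularity** (es's `not_uFamilyCuspidalImageNonzeroAtConductorSixteen_of_flat_four`
with S-es-g34-1′ discharged). [cite: BCDTJAMS2001, Thm. A] -/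
theorem not_uFamilyCuspidalImageNonzeroAtConductorSixteen_of_flat_four_of_modularity (hnf : exists_isNewformOf)
    (h : UFamilyFlatWitnessAtFour) : ¬ UFamilyCuspidalImageNonzeroAtConductorSixteen :=
  not_uFamilyCuspidalImageNonzeroAtConductorSixteen_of_flat_four (uFamilyNegOneTwinAtFour_of_modularity hnf) h

end Summit.BirchSwinnertonDyer.BirchSwinnertonDyer.Theorems.ManinLocalTwoThree.UFamilyTwin

end
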